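import Literature.MathematicalPhysics.QuantumLattice.HubbardTTPrimeGrandCanonicalPressure
import Literature.MathematicalPhysics.QuantumLattice.SectorPartitionFnCut
import Literature.MathematicalPhysics.QuantumLattice.HubbardOpenBoxGeneralPairClusterPSD
import Literature.MathematicalPhysics.QuantumLattice.HubbardTTPrimeThermalPressureZeemanBrackets
import HarnessLib

/-!
# A CAP on a cluster partition function from its SECTOR GROUND-ENERGY FLOORS:
# `Re Tr e^{−βA} ≤ Σ_{a,b ≤ |Λ|} |sector (a,b)| · e^{−β q_{a+b}}` whenever `q_k ≤ E₀(A, k)` (`β ≥ 0`)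

Topic `Literature/MathematicalPhysics/QuantumLattice` (family `hubbard`; crew hubbard-fast S2 «T > 0 certificate family», seat hubbard-box-p1).
The `T > 0` cluster CAPS on thermodynamic-limit pressures (`HubbardTTPrimeOpenBoxGrandCanonicalPressureCap` for the one-band `t–t′` model,
`WeightedOpenClusterBoundsPeriodic.perVarPressure_le_log_partitionFn_reweight` / `EmeryThreeBandThermalPressure.emeryCellPressure_le_log_partitionFn_boost`
for decorated and three-band models) want a certified UPPER bound on `log Re Tr e^{−βH}` of an open (boundary-boosted) cluster. Full spectra of the
clusters of interest (`Cu₄O₈`: Fock dimension `2²⁴`) are out of reach, but the kernel cluster device (hubbard-box-p2's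
`groundEnergy_ge_of_kCertsGP₃`) certifies FLOORS `q_k ≤ E₀(H, k)` on every particle-number sector. This file turns such floors into a cap:

* §1 `sectorEigenvalue_ge_groundEnergy`: every eigenvalue of the compression of a sector-preserving Hermitian `A` to the spin sector `(a, b)` is
  `≥ E₀(A, a+b)` (its zero-extended eigenvector is a unit `(a+b)`-particle vector); hence
  `Re Z_β(A|_{(a,b)}) ≤ |spinConfig a b| · e^{−β E₀(A,a+b)} ≤ C(|Λ|,a) C(|Λ|,b) · e^{−β q_{a+b}}` for `β ≥ 0` (`partitionFn_spinSector_re_le_card_mul_exp`).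
* §2 **`partitionFn_re_le_sum_choose_mul_exp_of_sector_floors`**: for `A` Hermitian and sector-preserving on the fermion Fock space over `Λ`,
  `β ≥ 0` and floors `q_k ≤ E₀(A, k)` (`k ≤ 2|Λ|`):
  **`Re Z_β(A) ≤ Σ_{a ≤ |Λ|} Σ_{b ≤ |Λ|} C(|Λ|,a)·C(|Λ|,b)·e^{−β q_{a+b}}`** and its logarithmic form — the «T = 0 floors + full sector entropies» cap
  (sharp as `β → ∞`, loose by at most `log` of the largest sector dimension).
* §3 the general-pair cluster reading (`log_partitionFn_hubbardOpenBoxGP_le_of_sector_floors`): for `hubbardOpenBoxGP a b τ υ ν` (`τ` symmetric) the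
  hypothesis is literally the conclusion shape of `groundEnergy_ge_of_kCertsGP₃`.

Everything is PROVED (0 sorry); no definition, no named fact, no number. HONEST SCOPE: a crude but certified cap; paired with the Peierls
orthonormal-family floor (`PeierlsOrthonormalFamily`) it brackets `log Z` of a cluster from ground-state-type certificates alone.

## Tree / Mathlib search

REUSED: `spinConfig`, `spinSectorHamiltonian`, `partitionFn_spinSectorHamiltonian_re`, `apply_eq_zero_of_preservesSectors`, `sectorEigenvector_apply_of_not_mem`
(`SectorPartitionFnCut`); `sectorEigenvalue/vector`, `re_rayleigh_sectorEigenvector`, `star_sectorEigenvector_dotProduct_self` (`TorusSectorGibbsMixture`);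
`partitionFn_sub_smul_totalNumber_re_eq_sum` (`HubbardTTPrimeGrandCanonicalPressure`); `groundEnergy_le_re_expect`, `IsInSector.isNParticle`,
`isInSector_iff_support`, `PreservesSectors` (`HubbardWave0LiebProofs`, `HubbardLiebConfig`); `card_subtype_spinConfig_le_choose_mul_choose`
(`HubbardTTPrimeThermalPressureZeemanBrackets`); `hubbardOpenBoxGP_isHermitian`, `preservesSectors_hubbardOpenBoxGP` (`HubbardOpenBoxGeneralPairCluster(PSD)`);
`partitionFn_re_pos`. `lean search 'partitionFn_le_card_mul_exp'` — only the one-sector form `LiebFluxPhaseProofs.partitionFn_le_card_mul_exp` (whole space).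

## References

* D. Ruelle, *Statistical Mechanics: Rigorous Results* (1969), §2.5–2.6 and §3.4 (sector decomposition of traces). [cite: Ruelle1969, §3.4]
* R. B. Israel, *Convexity in the Theory of Lattice Gases* (1979), Lemma II.3.1. [cite: Israel1979, Lemma II.3.1]
* H. Tasaki, *Physics and Mathematics of Quantum Many-Body Systems* (2020), §2.2 (symmetry sectors). [cite: Tasaki2020, §2.2]
-/

noncomputable section

open scoped ComplexOrder BigOperators
open Finset

namespace Literature.MathematicalPhysics.QuantumLattice

open Matrix HubbardWave0 LiebThm1 ThermodynamicLimit

variable {Λ : Type*} [LinearOrder Λ] [Fintype Λ]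

/-! ### §1. Sector eigenvalues are bounded below by the sector ground energy -/

/-- **Every eigenvalue of the compression `A|_{(a,b)}` of a sector-preserving Hermitian `A` is `≥ E₀(A, a+b)`** (its zero-extended eigenvector is a
unit `(a+b)`-particle vector with that Rayleigh quotient). [cite: Tasaki2020, §2.2] -/
theorem sectorEigenvalue_ge_groundEnergy {A : Matrix (Finset (Orb Λ)) (Finset (Orb Λ)) ℂ} (hA : A.IsHermitian) (hP : PreservesSectors A)
    (a b : ℕ) (c : Subtype (spinConfig (Λ := Λ) a b)) :
    groundEnergy A (a + b) ≤ sectorEigenvalue (spinConfig a b) A hA c := by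
  have hinv : ∀ s s' : Finset (Orb Λ), ¬ spinConfig a b s → spinConfig a b s' → A s s' = 0 :=
    fun s s' hs hs' => apply_eq_zero_of_preservesSectors hP a b s s' hs hs'
  have hsec : IsInSector a b (sectorEigenvector (spinConfig a b) A hA c) :=
    (isInSector_iff_support a b _).2 fun s hs => sectorEigenvector_apply_of_not_mem (spinConfig a b) A hA c hs
  have h := LiebThm1.groundEnergy_le_re_expect A hsec.isNParticle (star_sectorEigenvector_dotProduct_self (spinConfig a b) A hA c)
  rwa [expect, re_rayleigh_sectorEigenvector (spinConfig a b) hA hinv c] at h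

/-- **One sector**: `Re Z_β(A|_{(a,b)}) ≤ |spinConfig a b| · e^{−β E₀(A, a+b)}` (`β ≥ 0`). [cite: Ruelle1969, §3.4] -/
theorem partitionFn_spinSector_re_le_card_mul_exp_groundEnergy {A : Matrix (Finset (Orb Λ)) (Finset (Orb Λ)) ℂ} (hA : A.IsHermitian)
    (hP : PreservesSectors A) {β : ℝ} (hβ : 0 ≤ β) (a b : ℕ) :
    (partitionFn β (spinSectorHamiltonian a b A)).re ≤
      (Fintype.card (Subtype (spinConfig (Λ := Λ) a b)) : ℝ) * Real.exp (-(β * groundEnergy A (a + b))) := by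
  rw [partitionFn_spinSectorHamiltonian_re a b hA β]
  calc ∑ c, Real.exp (-(β * sectorEigenvalue (spinConfig a b) A hA c))
      ≤ ∑ _c : Subtype (spinConfig (Λ := Λ) a b), Real.exp (-(β * groundEnergy A (a + b))) :=
        Finset.sum_le_sum fun c _ => Real.exp_le_exp.2 (by nlinarith [sectorEigenvalue_ge_groundEnergy hA hP a b c])
    _ = _ := by rw [Finset.sum_const, Finset.card_univ, nsmul_eq_mul]

/-- **One sector, from a floor**: `q ≤ E₀(A, a+b)` ⇒ `Re Z_β(A|_{(a,b)}) ≤ C(|Λ|,a)·C(|Λ|,b)·e^{−βq}` (`β ≥ 0`). [cite: Ruelle1969, §3.4] -/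
theorem partitionFn_spinSector_re_le_choose_mul_exp {A : Matrix (Finset (Orb Λ)) (Finset (Orb Λ)) ℂ} (hA : A.IsHermitian)
    (hP : PreservesSectors A) {β : ℝ} (hβ : 0 ≤ β) (a b : ℕ) {q : ℝ} (hq : q ≤ groundEnergy A (a + b)) :
    (partitionFn β (spinSectorHamiltonian a b A)).re ≤
      ((Fintype.card Λ).choose a * (Fintype.card Λ).choose b : ℕ) * Real.exp (-(β * q)) := by
  refine (partitionFn_spinSector_re_le_card_mul_exp_groundEnergy hA hP hβ a b).trans ?_
  have hc : (Fintype.card (Subtype (spinConfig (Λ := Λ) a b)) : ℝ) ≤ ((Fintype.card Λ).choose a * (Fintype.card Λ).choose b : ℕ) := by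
    exact_mod_cast card_subtype_spinConfig_le_choose_mul_choose (Λ := Λ) a b
  have he : Real.exp (-(β * groundEnergy A (a + b))) ≤ Real.exp (-(β * q)) := Real.exp_le_exp.2 (by nlinarith)
  exact mul_le_mul hc he (Real.exp_pos _).le (Nat.cast_nonneg _)

/-! ### §2. The cap on the whole partition function -/

/-- **THE CAP FROM SECTOR GROUND-ENERGY FLOORS.** For `A` Hermitian and sector-preserving on the fermion Fock space over `Λ`, `β ≥ 0`, and floors
`q_k ≤ E₀(A, k)` for every particle number `k ≤ 2|Λ|`:
`Re Tr e^{−βA} ≤ Σ_{a ≤ |Λ|} Σ_{b ≤ |Λ|} C(|Λ|,a)·C(|Λ|,b)·e^{−β q_{a+b}}`. [cite: Ruelle1969, §3.4] [cite: Israel1979, Lemma II.3.1] -/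
theorem partitionFn_re_le_sum_choose_mul_exp_of_sector_floors {A : Matrix (Finset (Orb Λ)) (Finset (Orb Λ)) ℂ} (hA : A.IsHermitian)
    (hP : PreservesSectors A) {β : ℝ} (hβ : 0 ≤ β) {q : ℕ → ℝ} (hq : ∀ k ≤ 2 * Fintype.card Λ, q k ≤ groundEnergy A k) :
    (partitionFn β A).re ≤
      ∑ a ∈ Finset.range (Fintype.card Λ + 1), ∑ b ∈ Finset.range (Fintype.card Λ + 1),
        ((Fintype.card Λ).choose a * (Fintype.card Λ).choose b : ℕ) * Real.exp (-(β * q (a + b))) := by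
  have h0 : partitionFn β A = partitionFn β (A - ((0 : ℝ) : ℂ) • totalNumber) := by
    rw [Complex.ofReal_zero, zero_smul, sub_zero]
  rw [h0, partitionFn_sub_smul_totalNumber_re_eq_sum hP β 0]
  refine Finset.sum_le_sum fun a ha => Finset.sum_le_sum fun b hb => ?_
  rw [mul_zero, zero_mul, Real.exp_zero, one_mul]
  have hak : a ≤ Fintype.card Λ := Nat.lt_succ_iff.1 (Finset.mem_range.1 ha)
  have hbk : b ≤ Fintype.card Λ := Nat.lt_succ_iff.1 (Finset.mem_range.1 hb)
  exact partitionFn_spinSector_re_le_choose_mul_exp hA hP hβ a b (hq (a + b) (by omega))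

/-- **Logarithmic form**: `log Re Tr e^{−βA} ≤ log Σ_{a,b ≤ |Λ|} C(|Λ|,a)·C(|Λ|,b)·e^{−β q_{a+b}}` — a certified CAP on a cluster log-partition
function from its sector ground-energy floors. [cite: Ruelle1969, §3.4] [cite: Israel1979, Lemma II.3.1] -/
theorem log_partitionFn_le_of_sector_floors {A : Matrix (Finset (Orb Λ)) (Finset (Orb Λ)) ℂ} (hA : A.IsHermitian)
    (hP : PreservesSectors A) {β : ℝ} (hβ : 0 ≤ β) {q : ℕ → ℝ} (hq : ∀ k ≤ 2 * Fintype.card Λ, q k ≤ groundEnergy A k) :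
    Real.log (partitionFn β A).re ≤
      Real.log (∑ a ∈ Finset.range (Fintype.card Λ + 1), ∑ b ∈ Finset.range (Fintype.card Λ + 1),
        ((Fintype.card Λ).choose a * (Fintype.card Λ).choose b : ℕ) * Real.exp (-(β * q (a + b)))) := by
  haveI : Nonempty (Finset (Orb Λ)) := ⟨∅⟩
  exact Real.log_le_log (partitionFn_re_pos hA β) (partitionFn_re_le_sum_choose_mul_exp_of_sector_floors hA hP hβ hq)

/-- **Certified-number form**: if moreover the explicit sum is `≤ e^u`, then `log Re Tr e^{−βA} ≤ u`. [cite: Ruelle1969, §3.4] -/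
theorem log_partitionFn_le_of_sector_floors_of_sum_le {A : Matrix (Finset (Orb Λ)) (Finset (Orb Λ)) ℂ} (hA : A.IsHermitian)
    (hP : PreservesSectors A) {β : ℝ} (hβ : 0 ≤ β) {q : ℕ → ℝ} (hq : ∀ k ≤ 2 * Fintype.card Λ, q k ≤ groundEnergy A k) {u : ℝ}
    (hu : ∑ a ∈ Finset.range (Fintype.card Λ + 1), ∑ b ∈ Finset.range (Fintype.card Λ + 1),
        ((Fintype.card Λ).choose a * (Fintype.card Λ).choose b : ℕ) * Real.exp (-(β * q (a + b))) ≤ Real.exp u) :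
    Real.log (partitionFn β A).re ≤ u := by
  haveI : Nonempty (Finset (Orb Λ)) := ⟨∅⟩
  have h := (partitionFn_re_le_sum_choose_mul_exp_of_sector_floors hA hP hβ hq).trans hu
  have hpos := partitionFn_re_pos hA β
  calc Real.log (partitionFn β A).re ≤ Real.log (Real.exp u) := Real.log_le_log hpos h
    _ = u := Real.log_exp u

/-! ### §3. The general-pair cluster reading -/

namespace ClusterLowerBound

/-- **THE CAP FOR THE GENERAL-PAIR CLUSTER** (the device's object): for `hubbardOpenBoxGP a b τ υ ν` with `τ` symmetric, `β ≥ 0` and floors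
`q_k ≤ E₀(h^G, k)` for all `k ≤ 2ab` (the conclusion shape of `groundEnergy_ge_of_kCertsGP₃`),
`log Re Tr e^{−βh^G} ≤ log Σ_{p,p' ≤ ab} C(ab,p)·C(ab,p')·e^{−β q_{p+p'}}`. [cite: Ruelle1969, §3.4] [cite: ValentiStolzeHirschfeld1991, §II] -/
theorem log_partitionFn_hubbardOpenBoxGP_le_of_sector_floors (a b : ℕ) (τ : Fin a ×ₗ Fin b → Fin a ×ₗ Fin b → ℝ)
    (hτ : ∀ x y, τ x y = τ y x) (υ ν : Fin a ×ₗ Fin b → ℝ) {β : ℝ} (hβ : 0 ≤ β) {q : ℕ → ℝ}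
    (hq : ∀ k ≤ 2 * (a * b), q k ≤ groundEnergy (hubbardOpenBoxGP a b τ υ ν) k) :
    Real.log (partitionFn β (hubbardOpenBoxGP a b τ υ ν)).re ≤
      Real.log (∑ p ∈ Finset.range (a * b + 1), ∑ p' ∈ Finset.range (a * b + 1),
        (((a * b).choose p * (a * b).choose p' : ℕ) : ℝ) * Real.exp (-(β * q (p + p')))) := by
  have hcard : Fintype.card (Fin a ×ₗ Fin b) = a * b := card_rectSites a b
  have h := log_partitionFn_le_of_sector_floors (hubbardOpenBoxGP_isHermitian τ hτ υ ν) (preservesSectors_hubbardOpenBoxGP τ υ ν) hβ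
    (q := q) (by rw [hcard]; exact hq)
  rw [hcard] at h
  exact h

end ClusterLowerBound

end Literature.MathematicalPhysics.QuantumLattice

end
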